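/-
Copyright (c) 2026 the pub-hodgecm-mathlib formalisation cell (harness21).  Prover seat hodgecm-mathlib-LH4-p14 (g6), req620 Track A «(D-RAM) FOUR-FRAME» squad, helper lane
on h413 = stmt-HodgeConjecture-24833 (count-neutral).  STAGE-1b VEHICLE brick behind the (H-T+)-SIG sheet (dealer LH4-plan (g12) WORD #38; LH4-r01 BOX LI; REF5 R5-261).  2026-09-04.
-/
import Summits.HodgeConjecture.HodgeConjecture.Theorems.F0P3cDyRamPieceRowsOfFrameSignedCensus      -- ★ p858837 (c4): `pieceRowsWild_gselStar_of_frameSignedCensus`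
import Summits.HodgeConjecture.HodgeConjecture.Theorems.F0P3cDyRamFourFrameLawDefsR2                 -- ★ №1-R2: `OmegaSchedule`, `KappaSignLawAtS2` (the Ω-aware law currency of record)
import Summits.HodgeConjecture.HodgeConjecture.Theorems.F0P3cDyRamRowOneHSideAssembly             -- ★ p855670 §1 `eventually_nhds_one_le_depth`; brings ★ p855481 (slot∕`q_v = q_w` tools), `valued_eq_one_of_mul_map_eq_one`
import Summits.HodgeConjecture.HodgeConjecture.Theorems.F0P3cDyRamHFamilyAffineSpan               -- ★ p858715 `exists_coef_hFamily_affine`; brings DEFS №5 `hFamily`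
import Summits.HodgeConjecture.HodgeConjecture.Theorems.F0P3cDyRamPieceCountDictionaryProfiles     -- ★ p854797 (U2G): `pieceCountDictionary_transvPlus`
import Summits.HodgeConjecture.HodgeConjecture.Theorems.F0P3cDyRamFourFrameLawsDeepThreshold       -- ★ p857235: `fourFrameTransferFactorS_any` ((D-CΔ)-S at any schedule)
import Summits.HodgeConjecture.HodgeConjecture.Theorems.F0P3cDyRamPieceRowsWildUnit0OfExports      -- ★ p857318: `v_two_lt_one_of_not_isUnit_two` (the dyadic fence at a wild place)
import Literature.NumberTheory.Automorphic.AdicCompletionIntegerSpellings                          -- ★ `isUnit_two_valuationInteger_of_isUnit_two`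
import HarnessLib

set_option autoImplicit false

noncomputable section

/-!
# Crux `H413`, line LH4 «(D-RAM) FOUR-FRAME» — ROW (1) OF A PIECE FROM ITS κ-SIGNED CENSUS LAW WITH AN AMPLITUDE LETTER: three token-parametric vehicles
# ((V) the (c4) socket's H-side triple of `f_{T+}` from an (L-T+) law in ★ №1-R2 currency + the triple in the law's closed form; (V1) row (1) in closed form from the
# sign-free depth-only H-side identity, ★ p855299 with `ampl ↦ A`; (V2) that identity for `hFamily` from ONE affine arithmetic hypothesis on the token, ★ p858715)

Cell `hodgecm-mathlib` (D-0151), FLOOR 0, crux item H413 = `stmt-HodgeConjecture-24833`, route `HCCMUnconditional`; squad F0∕P3c∕LH4.  THEOREMS ONLY (no `def`, no instance, no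
notation, no `sorry`, default heartbeats); ★ `Theorems` imports only; lane `--supports stmt-HodgeConjecture-24833 --as helper`.  COUNT-NEUTRAL: no census law is asserted — the law
(`hLaw`), the H-side rows (`hH`) and the token arithmetic (`hA`) are HYPOTHESES with an abstract amplitude letter `A : ℕ → ℕ → ℕ → ℕ → ℤ → ℚ` (`A q d t_E k B`) and an abstract
sign-token schedule `Ω : OmegaSchedule` (★ №1-R2); the tier-0 row `stub_rows_transvPlus` stays OPEN until the STAGE-1b directive's producers ((L-T+) law, rows (2)(3)) exist.

WHY.  The open tier-0 row `F0P3cDyRamFourFrame.stub_rows_transvPlus : PieceRowsWild gselStar 1` reads, on the (c4) road ★ p858837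
`pieceRowsWild_gselStar_of_frameSignedCensus shift N₀ 1 pieceCountDictionary_transvPlus (fourFrameTransferFactorS_any shift N₀) ‹hDH›`, ONE H-side hypothesis `hDH` whose
row (1) realises `Δ‴(γ_H, t_{b₀})·νG₃(K)·Σ_b κ_i(b)·cntStar 1 (Γ_b)`.  A STAGE-1b producer pays it as (L-T+) a κ-signed census LAW `Σ_b κ_i(b)·cnt_{T+}(Γ_b) = Ω·S_i·A(q,d,t_E,k,B)`
(★ `KappaSignLawAtS2` currency, `fixedVertexCount σ ϖ 0 ↦ transvPlusFixCount σ ϖ d (d % 2) (mstarOfRecord d)`) composed with (H-T+)′ an H-side triple whose row (1) is keyed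
to the law's closed form.  This file supplies the compositions, token for token, so that at the directive only the TOKEN `A` and rows (2)(3) remain:
* §3 **`pieceRowsWild_gselStar_one_of_fencedLaw_of_hside (shift Ω N₀ A) (hL) (hH) : PieceRowsWild gselStar 1`** — THE JUNCTION (LH4-p05 (g8)'s (L-T+)-SIG §4, def-free):
  the tier-0 row's TYPE from the law behind the dyadic fence at every complete datum + the H-side triple in the law's closed form; ★ p858837 at `j := 1`, ★ U2G
  `pieceCountDictionary_transvPlus`, ★ `fourFrameTransferFactorS_any`; the fence (`2 ∉ 𝒪_w^×`, ★ p857318) and the place instantiation (`K := L_w`, `cntStar 1 = cntTransvPlus`,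
  ★ `dOfPlace_eq_of_isRamifiedQuadraticDatum`, `mstarFn = mstarOfRecord ∘ dOfPlace`, ℤ→ℚ→ℂ casts) discharged inside.
* §4 **`rowOne_of_hSideIdentity_token (shift Ω N₀ A) … (C) (ψ) (coef) (hH)`** : row (1) of (H-T+)′ for ANY finite family from the SIGN-FREE identity
  `Σ_s coef_s·Φ^st(γ_H, ψ_s) = C · q_v^{−(n₁+n₂)∕2} · (Ω_i · A(q_w, d, t_E, k, B))` on the row-(1) data — ★ p855299 `rowOne_of_hSideIdentity` with `ampl ↦ A` (★ «Δ2»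
  `exists_nhds_one_forall_rowOne_rhs_collapse` is amplitude-generic; ★ «T∕P», ★ «E»); piece-free.
* §5 **`exists_coef_hSideIdentity_hFamily_of_affine_token (shift Ω N₀ A) … (C cA cB) (N₁) (hA)`** : `∃ coef : Fin 2 → ℂ`, that sign-free identity for `ψ := hFamily`, from ONE
  arithmetic hypothesis `hA` — on the row data (slot `i = 2`, `n₁ + n₂` even, `2k + d = Σ nᵢ + 2`, `2B = n₃ − d + 2 − 2·shift d t_E`, `n₃ ≥ N₁`, `n₃ + d` even; `a, b` and the
  element datum handed for `Ω`) the collapsed amplitude is AFFINE `cA·V(n₃) + cB` in ★ (ρ1a)'s edge-ball count `V(N) = 2(q^{(N−d)∕2+1} − 1)∕(q − 1)` — ★ p858715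
  `exists_coef_hFamily_affine` + ★ p855670 §1 `eventually_nhds_one_le_depth` (depth floor `max N₁ (depthOfRecord d)` near `1`) + the slot∕root bookkeeping of ★ p855481∕p855670; piece-free.
So for `ψ := hFamily`: ROW (1) of `f_{T+}`'s H-side triple ⟸ (L-T+) + `hA` (§5 → §4), and the row itself ⟸ (L-T+) + the triple (§3); every ampl-affine token (`c·ampl(q, k − s, B − s′)` off its `max 0` corner, the fitted
shapes of p01 (g35) F2–F4) satisfies `hA` where `Ω = 1`.  Rows (2)(3) are carried verbatim (their producers: type-(2) census of `f_{T+}`; Levi ★ p858969∕p858846 + a third profile).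
HONEST LABEL.  Count-neutral (`--supports`); pays no registered stub, touches no `Lines/` module; `HC_CM` is proved only modulo the 7 printed citations (2 remaining named inputs:
hLiu418 = `stmt-HodgeConjecture-24832`, h413 = `stmt-HodgeConjecture-24833`) until rung 0 closes.

## References
* [Rogawski1990] J. D. Rogawski, *Automorphic Representations of Unitary Groups in Three Variables*, Ann. of Math. Stud. 123 (1990): §4.9 Prop. 4.9.1 (a)(b) p. 55, Lemma 4.9.3 (4.9.2) p. 56; §8.1 Prop. 8.1.2 (b) p. 113.
* [LanglandsShelstad1987] R. P. Langlands, D. Shelstad, *On the definition of transfer factors*, Math. Ann. 278 (1987), §1.3, §3.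
* [LabesseLanglands1979] J.-P. Labesse, R. P. Langlands, *L-indistinguishability for SL(2)*, Canad. J. Math. 31 (1979), §2 (2.1)–(2.2).
* [Kottwitz1986BaseChangeUnits] R. E. Kottwitz, *Base change for unit elements of Hecke algebras*, Compositio Math. 60 (1986), §1 pp. 240–241.
-/

namespace Summit.HodgeConjecture.HodgeConjecture.Cruxes.H413.F0P3cDyRamPieceRowOneTokenVehicles

open MeasureTheory Measure NumberField IsDedekindDomain Topology Filter
open Literature.NumberTheory.Automorphic Literature.NumberTheory.Automorphic.UnitaryGroup Literature.NumberTheory.Automorphic.IntegralReduction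
open Literature.NumberTheory.Automorphic.UnitaryLatticeTree Literature.NumberTheory.Automorphic.HermitianLattice
open Literature.NumberTheory.Rogawski1990 Literature.NumberTheory.GaloisRepresentations
open Literature.MeasureTheory.Group (descConj)
open scoped Matrix MatrixGroups Classical ValuativeRel WithZero
open Literature.NumberTheory.Automorphic.UnitaryThreeFourFrame
open Summit.HodgeConjecture.HodgeConjecture.Cruxes.H413.F0P3cDyRamFourFrameLawDefs
open Summit.HodgeConjecture.HodgeConjecture.Cruxes.H413.F0P3cDyRamFourFrameLawDefsR
open Summit.HodgeConjecture.HodgeConjecture.Cruxes.H413.F0P3cDyRamFourFrameLawDefsR2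
open Summit.HodgeConjecture.HodgeConjecture.Cruxes.H413.F0P3cDyRamFourFrameHSideDefs
open Summit.HodgeConjecture.HodgeConjecture.Cruxes.H413.F0P3cDyRamFourFrameHSideDefsR
open Summit.HodgeConjecture.HodgeConjecture.Cruxes.H413.F0P3cDyRamFourFrameCensusDefs
open Summit.HodgeConjecture.HodgeConjecture.Cruxes.H413.F0P3cDyRamFourFramePieces
open Summit.HodgeConjecture.HodgeConjecture.Cruxes.H413.F0P3cDyRamDOfPlaceOfDatum
open Summit.HodgeConjecture.HodgeConjecture.Cruxes.H413.F0P3cDyRamFourFrameLawsDeepThreshold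
open Summit.HodgeConjecture.HodgeConjecture.Cruxes.H413.F0P3cDyRamPieceCountDictionaryProfiles
open Summit.HodgeConjecture.HodgeConjecture.Cruxes.H413.F0P3cDyRamPieceRowsWildUnit0OfExports
open Summit.HodgeConjecture.HodgeConjecture.Cruxes.H413.F0P3cDyRamPieceRowsOfFrameSignedCensus
open Summit.HodgeConjecture.HodgeConjecture.Cruxes.H413.F0P3cDyRamRowOneDeltaBaseValue
open Summit.HodgeConjecture.HodgeConjecture.Cruxes.H413.F0P3cDyRamRowOneDepthToken
open Summit.HodgeConjecture.HodgeConjecture.Cruxes.H413.F0P3cDyRamRowOneRootDepth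
open Summit.HodgeConjecture.HodgeConjecture.Cruxes.H413.F0P3cDyRamRowOneReductionDepth
open Summit.HodgeConjecture.HodgeConjecture.Cruxes.H413.F0P3cDyRamRowOneHSideAssembly
open Summit.HodgeConjecture.HodgeConjecture.Cruxes.H413.F0P3cDyRamHFamilyAffineSpan
open Summit.HodgeConjecture.HodgeConjecture.Cruxes.H413.F0P3cDyRamFourFrameHFamilyDefs
open Summit.HodgeConjecture.HodgeConjecture.Cruxes.H413.F0P3cDyRamCayleySignFPartProd


/-! ## §3  (V) THE JUNCTION: the tier-0 row type `PieceRowsWild gselStar 1` from a FENCED (L-T+) law in ★ №1-R2 currency and the H-side triple in the law's closed form -/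

/-- **(V) THE JUNCTION `pieceRowsWild_gselStar_one_of_fencedLaw_of_hside`** (= LH4-p05 (g8)'s §4 junction, def-free).  `hL` = the κ-signed census law of
`transvPlusFixCount σ ϖ d (d % 2) (mstarOfRecord d)` in ★ `KappaSignLawAtS2 shift Ω N₀` currency (binder block verbatim, type-0 conjunct, no τ; amplitude letter `A q d t k B`)
at every complete datum BEHIND THE DYADIC FENCE (★ `DyadicFence`); `hH` = ★ p858837's `hDH` (j := 1) with row (1)'s signed census replaced by
`((Ω·baseSign·normSign : ℤ) : ℂ) * ((A q_w d t_E k B : ℚ) : ℂ)`; conclusion = the tier-0 row type `PieceRowsWild gselStar 1` (★ p858837 + ★ U2G dictionary + ★ (D-CΔ)-S at the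
schedule); the fence (`2 ∉ 𝒪_w^×`) and the place instantiation of the law (`cntStar 1 = cntTransvPlus`, ★ `dOfPlace = d`, `mstarFn = mstarOfRecord ∘ dOfPlace`, casts) are discharged inside.
[cite: Rogawski1990, §4.9 Prop. 4.9.1 (a) p. 55] [cite: LanglandsShelstad1987, §1.3, §3] [cite: Kottwitz1986BaseChangeUnits, §1 pp. 240–241] -/
theorem pieceRowsWild_gselStar_one_of_fencedLaw_of_hside (shift : ℕ → ℕ → ℤ) (Ω : OmegaSchedule) (N₀ : ℕ → ℕ) (A : ℕ → ℕ → ℕ → ℕ → ℤ → ℚ)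
    (hL : ∀ {K : Type} [Field K] [Valued K ℤᵐ⁰] [CompleteSpace K] [Fintype (Valued.ResidueField K)] (σ : K →+* K) (ϖ : K) (d t : ℕ),
      DyadicFence (K := K) (
      IsRamifiedQuadraticDatum σ ϖ d t →
      ∀ (f : Fin 4 → Fin 3 → (Fin 3 → K)), IsFourFrameFamily σ f →
      ∀ (δ : K), σ δ = -δ → δ ≠ 0 →
      ∀ (a b : K), a * σ a = 1 → b * σ b = 1 → Valued.v (a - 1) < Valued.v (2 : K) → Valued.v (b - 1) < Valued.v (2 : K) →
      ∀ (n₁ n₂ n₃ : ℕ), IsElementDatum σ ϖ (N₀ d) (a * a) (b * b) n₁ n₂ n₃ →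
      ∀ (Γ : Fin 4 → GL (Fin 3) K), (∀ b', (Γ b' : Matrix (Fin 3) (Fin 3) K) = frameElt σ f b' (a * a) (b * b)) →
      ∀ (k : ℕ), 2 * k + d = n₁ + n₂ + n₃ + 2 →
      ∀ (i : Fin 3) (B : ℤ), 2 * B = ((![n₁, n₂, n₃] : Fin 3 → ℕ) i : ℤ) - d + 2 - 2 * shift d t →
        ((∑ b' : Fin 4, kappaChar i b' * (transvPlusFixCount σ ϖ d (d % 2) (mstarOfRecord d) (Γ b') : ℤ) : ℤ) : ℚ) =
          (Ω K σ ϖ d a b i * (baseSign σ i * normSign σ (fPartProd δ ![a, b, 1] i)) : ℤ) * A (Fintype.card (Valued.ResidueField K)) d t k B))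
    (hH :
      ∀ (L : Type) [Field L] [NumberField L] [IsCMField L]
        {v : HeightOneSpectrum (𝓞 ↥(maximalRealSubfield L))} (w : UnitaryGroup.PlacesOver L v)
        (hw : IsCMField.complexConj L • w.1 = w.1) (_he : v.asIdeal.ramificationIdx' w.1.asIdeal ≠ 1)
        (_h2 : ¬ IsUnit (2 : 𝒪[w.1.adicCompletion L]))
        (ϖ : (w.1.adicCompletion L)) (_hϖ : Valued.v ϖ = WithZero.exp (-1 : ℤ)) (d tE : ℕ) (_hD : IsRamifiedQuadraticDatum (galAdicCompletionMap (L := L) (IsCMField.complexConj L) hw) ϖ d tE)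
        [Fintype (Valued.ResidueField (w.1.adicCompletion L))] (δ : (w.1.adicCompletion L)) (_hδ : (galAdicCompletionMap (L := L) (IsCMField.complexConj L) hw) δ = -δ) (_hδ0 : δ ≠ 0)
        (μ : HeckeCharacter L) (_hμu : μ.IsUnitary)
        (_hμω : ∀ x : ideleGroup ↥(maximalRealSubfield L), μ (AdeleRing.ideleBaseChange ↥(maximalRealSubfield L) L x) = quadraticHeckeCharCM L x)
        [MeasurableSpace ((UnitaryGroup.cmDatum L 3 (Matrix.of fun i j : Fin 3 => if i.val + j.val + 1 = 3 then (1 : L) else 0)).Local v)] [BorelSpace ((UnitaryGroup.cmDatum L 3 (Matrix.of fun i j : Fin 3 => if i.val + j.val + 1 = 3 then (1 : L) else 0)).Local v)]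
        [∀ γ : ((UnitaryGroup.cmDatum L 3 (Matrix.of fun i j : Fin 3 => if i.val + j.val + 1 = 3 then (1 : L) else 0)).Local v), MeasurableSpace (((UnitaryGroup.cmDatum L 3 (Matrix.of fun i j : Fin 3 => if i.val + j.val + 1 = 3 then (1 : L) else 0)).Local v) ⧸ Subgroup.centralizer ({γ} : Set ((UnitaryGroup.cmDatum L 3 (Matrix.of fun i j : Fin 3 => if i.val + j.val + 1 = 3 then (1 : L) else 0)).Local v)))]
        [∀ γ : ((UnitaryGroup.cmDatum L 3 (Matrix.of fun i j : Fin 3 => if i.val + j.val + 1 = 3 then (1 : L) else 0)).Local v), BorelSpace (((UnitaryGroup.cmDatum L 3 (Matrix.of fun i j : Fin 3 => if i.val + j.val + 1 = 3 then (1 : L) else 0)).Local v) ⧸ Subgroup.centralizer ({γ} : Set ((UnitaryGroup.cmDatum L 3 (Matrix.of fun i j : Fin 3 => if i.val + j.val + 1 = 3 then (1 : L) else 0)).Local v)))]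
        [MeasurableSpace ((UnitaryGroup.cmDatum L 2 (Matrix.of fun i j : Fin 2 => if i.val + j.val + 1 = 2 then (1 : L) else 0)).Local v × (UnitaryGroup.cmDatum L 1 (Matrix.of fun i j : Fin 1 => if i.val + j.val + 1 = 1 then (1 : L) else 0)).Local v)] [BorelSpace ((UnitaryGroup.cmDatum L 2 (Matrix.of fun i j : Fin 2 => if i.val + j.val + 1 = 2 then (1 : L) else 0)).Local v × (UnitaryGroup.cmDatum L 1 (Matrix.of fun i j : Fin 1 => if i.val + j.val + 1 = 1 then (1 : L) else 0)).Local v)]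
        [∀ a : ((UnitaryGroup.cmDatum L 2 (Matrix.of fun i j : Fin 2 => if i.val + j.val + 1 = 2 then (1 : L) else 0)).Local v × (UnitaryGroup.cmDatum L 1 (Matrix.of fun i j : Fin 1 => if i.val + j.val + 1 = 1 then (1 : L) else 0)).Local v), MeasurableSpace (((UnitaryGroup.cmDatum L 2 (Matrix.of fun i j : Fin 2 => if i.val + j.val + 1 = 2 then (1 : L) else 0)).Local v × (UnitaryGroup.cmDatum L 1 (Matrix.of fun i j : Fin 1 => if i.val + j.val + 1 = 1 then (1 : L) else 0)).Local v) ⧸ Subgroup.centralizer ({a} : Set ((UnitaryGroup.cmDatum L 2 (Matrix.of fun i j : Fin 2 => if i.val + j.val + 1 = 2 then (1 : L) else 0)).Local v × (UnitaryGroup.cmDatum L 1 (Matrix.of fun i j : Fin 1 => if i.val + j.val + 1 = 1 then (1 : L) else 0)).Local v)))]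
        [∀ a : ((UnitaryGroup.cmDatum L 2 (Matrix.of fun i j : Fin 2 => if i.val + j.val + 1 = 2 then (1 : L) else 0)).Local v × (UnitaryGroup.cmDatum L 1 (Matrix.of fun i j : Fin 1 => if i.val + j.val + 1 = 1 then (1 : L) else 0)).Local v), BorelSpace (((UnitaryGroup.cmDatum L 2 (Matrix.of fun i j : Fin 2 => if i.val + j.val + 1 = 2 then (1 : L) else 0)).Local v × (UnitaryGroup.cmDatum L 1 (Matrix.of fun i j : Fin 1 => if i.val + j.val + 1 = 1 then (1 : L) else 0)).Local v) ⧸ Subgroup.centralizer ({a} : Set ((UnitaryGroup.cmDatum L 2 (Matrix.of fun i j : Fin 2 => if i.val + j.val + 1 = 2 then (1 : L) else 0)).Local v × (UnitaryGroup.cmDatum L 1 (Matrix.of fun i j : Fin 1 => if i.val + j.val + 1 = 1 then (1 : L) else 0)).Local v)))]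
        (νH : Measure ((UnitaryGroup.cmDatum L 2 (Matrix.of fun i j : Fin 2 => if i.val + j.val + 1 = 2 then (1 : L) else 0)).Local v × (UnitaryGroup.cmDatum L 1 (Matrix.of fun i j : Fin 1 => if i.val + j.val + 1 = 1 then (1 : L) else 0)).Local v)) [νH.IsHaarMeasure] [νH.IsMulRightInvariant]
        (νG₃ : Measure ((UnitaryGroup.cmDatum L 3 (Matrix.of fun i j : Fin 3 => if i.val + j.val + 1 = 3 then (1 : L) else 0)).Local v)) [νG₃.IsHaarMeasure] [νG₃.IsMulRightInvariant]
        (mH : OrbitalMeasureFamily ((UnitaryGroup.cmDatum L 2 (Matrix.of fun i j : Fin 2 => if i.val + j.val + 1 = 2 then (1 : L) else 0)).Local v × (UnitaryGroup.cmDatum L 1 (Matrix.of fun i j : Fin 1 => if i.val + j.val + 1 = 1 then (1 : L) else 0)).Local v)) (mG₃ : OrbitalMeasureFamily ((UnitaryGroup.cmDatum L 3 (Matrix.of fun i j : Fin 3 => if i.val + j.val + 1 = 3 then (1 : L) else 0)).Local v))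
        (_hmH : mH.IsCanonical (IsLocalGRegular L v) νH) (_hmG : mG₃.IsCanonical (fun γ => IsRegularElt (γ.val : GL (Fin 3) (UnitaryGroup.LocalRing L v))) νG₃),
        ∃ (r : ℕ) (ψ : Fin r → ((UnitaryGroup.cmDatum L 2 (Matrix.of fun i j : Fin 2 => if i.val + j.val + 1 = 2 then (1 : L) else 0)).Local v × (UnitaryGroup.cmDatum L 1 (Matrix.of fun i j : Fin 1 => if i.val + j.val + 1 = 1 then (1 : L) else 0)).Local v) → ℂ) (_ : ∀ s, IsLocSmooth (ψ s)) (coef : Fin r → ℂ),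
          -- ROW (1): the H-side realises THE κ-SIGNED CENSUS OF THE PIECE OVER THE FOUR FRAMES `Γ_b` times the base transfer factor (no law pre-evaluated)
          (∃ V ∈ 𝓝 (1 : ((UnitaryGroup.cmDatum L 2 (Matrix.of fun i j : Fin 2 => if i.val + j.val + 1 = 2 then (1 : L) else 0)).Local v × (UnitaryGroup.cmDatum L 1 (Matrix.of fun i j : Fin 1 => if i.val + j.val + 1 = 1 then (1 : L) else 0)).Local v)), ∀ γH ∈ V, IsLocalGRegular L v γH →
            ∀ (f : Fin 4 → Fin 3 → (Fin 3 → (w.1.adicCompletion L))) (_hf : IsFourFrameFamily (galAdicCompletionMap (L := L) (IsCMField.complexConj L) hw) f)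
          (a b z : (w.1.adicCompletion L)) (_ha : a * (galAdicCompletionMap (L := L) (IsCMField.complexConj L) hw) a = 1) (_hb : b * (galAdicCompletionMap (L := L) (IsCMField.complexConj L) hw) b = 1) (_hz : z * (galAdicCompletionMap (L := L) (IsCMField.complexConj L) hw) z = 1)
          (_hzγ : z = finGammaTwo L v γH w) (_hra : ((((γH).1.val : GL (Fin 2) (UnitaryGroup.LocalRing L v)).val.map (Pi.evalRingHom (fun w' : UnitaryGroup.PlacesOver L v => w'.1.adicCompletion L) w))).charpoly.IsRoot (z * (a * a))) (_hrb : ((((γH).1.val : GL (Fin 2) (UnitaryGroup.LocalRing L v)).val.map (Pi.evalRingHom (fun w' : UnitaryGroup.PlacesOver L v => w'.1.adicCompletion L) w))).charpoly.IsRoot (z * (b * b)))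
          (_ha1 : Valued.v (a - 1) < Valued.v (2 : (w.1.adicCompletion L))) (_hb1 : Valued.v (b - 1) < Valued.v (2 : (w.1.adicCompletion L)))
          (n₁ n₂ n₃ : ℕ) (_hE : IsElementDatum (galAdicCompletionMap (L := L) (IsCMField.complexConj L) hw) ϖ (N₀ d) (a * a) (b * b) n₁ n₂ n₃)
          (k : ℕ) (_hk : 2 * k + d = n₁ + n₂ + n₃ + 2)
          (Γ : Fin 4 → GL (Fin 3) (w.1.adicCompletion L)) (_hΓ : ∀ b', (Γ b' : Matrix (Fin 3) (Fin 3) (w.1.adicCompletion L)) = frameElt (galAdicCompletionMap (L := L) (IsCMField.complexConj L) hw) f b' (a * a) (b * b))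
          (tb : Fin 4 → ((UnitaryGroup.cmDatum L 3 (Matrix.of fun i j : Fin 3 => if i.val + j.val + 1 = 3 then (1 : L) else 0)).Local v)) (_htb : ∀ b', ((((localNonsplitEquiv (IsCMField.complexConj L) (Matrix.of fun i j : Fin 3 => if i.val + j.val + 1 = 3 then (1 : L) else 0) (IsCMField.complexConj_ne_one L) w hw (tb b') :
                ↥(unitaryGroupOfForm (galAdicCompletionMap (L := L) (IsCMField.complexConj L) hw) (placeForm (Matrix.of fun i j : Fin 3 => if i.val + j.val + 1 = 3 then (1 : L) else 0) w.1))) : GL (Fin 3) (w.1.adicCompletion L)) : Matrix (Fin 3) (Fin 3) (w.1.adicCompletion L))) = z • (Γ b' : Matrix (Fin 3) (Fin 3) (w.1.adicCompletion L)))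
              (i : Fin 3) (B : ℤ), 2 * B = ((![n₁, n₂, n₃] : Fin 3 → ℕ) i : ℤ) - d + 2 - 2 * shift d tE →
              (∀ t' : ((UnitaryGroup.cmDatum L 3 (Matrix.of fun i j : Fin 3 => if i.val + j.val + 1 = 3 then (1 : L) else 0)).Local v), IsLocalNormPair L (Matrix.of fun i j : Fin 3 => if i.val + j.val + 1 = 3 then (1 : L) else 0) v γH t' ↔ ∃ b', ConjClasses.mk t' = ConjClasses.mk (tb b')) →
              (∀ b' : Fin 4, ((finExplicitCollection L (Matrix.of fun i j : Fin 3 => if i.val + j.val + 1 = 3 then (1 : L) else 0) μ (finExplicitDelta_conj_left_all L (Matrix.of fun i j : Fin 3 => if i.val + j.val + 1 = 3 then (1 : L) else 0) μ) (finExplicitDelta_conj_right_all L (Matrix.of fun i j : Fin 3 => if i.val + j.val + 1 = 3 then (1 : L) else 0) μ)) v).Δ γH (tb b') = ((finExplicitCollection L (Matrix.of fun i j : Fin 3 => if i.val + j.val + 1 = 3 then (1 : L) else 0) μ (finExplicitDelta_conj_left_all L (Matrix.of fun i j : Fin 3 => if i.val + j.val + 1 = 3 then (1 : L) else 0) μ)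 (finExplicitDelta_conj_right_all L (Matrix.of fun i j : Fin 3 => if i.val + j.val + 1 = 3 then (1 : L) else 0) μ)) v).Δ γH (tb 0) * (kappaChar i b' : ℂ)) →
              ∑ s, coef s * stableOrbitalIntegralRel (IsLocalStablyConjH L v) mH (ψ s) γH =
                ((finExplicitCollection L (Matrix.of fun i j : Fin 3 => if i.val + j.val + 1 = 3 then (1 : L) else 0) μ (finExplicitDelta_conj_left_all L (Matrix.of fun i j : Fin 3 => if i.val + j.val + 1 = 3 then (1 : L) else 0) μ) (finExplicitDelta_conj_right_all L (Matrix.of fun i j : Fin 3 => if i.val + j.val + 1 = 3 then (1 : L) else 0) μ)) v).Δ γH (tb 0) * ((νG₃ (cmLocalIntegralLevel L 3 (Matrix.of fun i j : Fin 3 => if i.val + j.val + 1 = 3 then (1 : L) else 0) v : Set ((UnitaryGroup.cmDatum L 3 (Matrix.of fun i j : Fin 3 => if i.val + j.val + 1 = 3 then (1 : L) else 0)).Local v))).toReal : ℂ) *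
                  (((Ω (w.1.adicCompletion L) (galAdicCompletionMap (L := L) (IsCMField.complexConj L) hw) ϖ d a b i * (baseSign (galAdicCompletionMap (L := L) (IsCMField.complexConj L) hw) i * normSign (galAdicCompletionMap (L := L) (IsCMField.complexConj L) hw) (fPartProd δ ![a, b, 1] i)) : ℤ) : ℂ) *
                    ((A (Fintype.card (Valued.ResidueField (w.1.adicCompletion L))) d tE k B : ℚ) : ℂ))) ∧
          -- ROW (2), type (2), transfer-shaped (law debt)
          (∃ V ∈ 𝓝 (1 : ((UnitaryGroup.cmDatum L 2 (Matrix.of fun i j : Fin 2 => if i.val + j.val + 1 = 2 then (1 : L) else 0)).Local v × (UnitaryGroup.cmDatum L 1 (Matrix.of fun i j : Fin 1 => if i.val + j.val + 1 = 1 then (1 : L) else 0)).Local v)), ∀ γH ∈ V, IsLocalGRegular L v γH →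
          ¬ (∃ x : (w.1.adicCompletion L), (((((γH).1.val : GL (Fin 2) (UnitaryGroup.LocalRing L v)).val.map (Pi.evalRingHom (fun w' : UnitaryGroup.PlacesOver L v => w'.1.adicCompletion L) w))).charpoly).IsRoot x) →
          ∑ᶠ c : ConjClasses ((UnitaryGroup.cmDatum L 3 (Matrix.of fun i j : Fin 3 => if i.val + j.val + 1 = 3 then (1 : L) else 0)).Local v), ((finExplicitCollection L (Matrix.of fun i j : Fin 3 => if i.val + j.val + 1 = 3 then (1 : L) else 0) μ (finExplicitDelta_conj_left_all L (Matrix.of fun i j : Fin 3 => if i.val + j.val + 1 = 3 then (1 : L) else 0) μ) (finExplicitDelta_conj_right_all L (Matrix.of fun i j : Fin 3 => if i.val + j.val + 1 = 3 then (1 : L) else 0) μ)) v).Δ γH (Quotient.out c) * classOrbitalIntegral mG₃ ((gselStar 1) L v w hw ϖ) c =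
            ∑ s, coef s * stableOrbitalIntegralRel (IsLocalStablyConjH L v) mH (ψ s) γH) ∧
          -- ROW (3), Levi, transfer-shaped (law debt)
          (∃ V ∈ 𝓝 (1 : ((UnitaryGroup.cmDatum L 2 (Matrix.of fun i j : Fin 2 => if i.val + j.val + 1 = 2 then (1 : L) else 0)).Local v × (UnitaryGroup.cmDatum L 1 (Matrix.of fun i j : Fin 1 => if i.val + j.val + 1 = 1 then (1 : L) else 0)).Local v)), ∀ γH ∈ V, IsLocalGRegular L v γH →
          (∃ (y : ((UnitaryGroup.cmDatum L 2 (Matrix.of fun i j : Fin 2 => if i.val + j.val + 1 = 2 then (1 : L) else 0)).Local v × (UnitaryGroup.cmDatum L 1 (Matrix.of fun i j : Fin 1 => if i.val + j.val + 1 = 1 then (1 : L) else 0)).Local v)) (d' : Fin 2 → (UnitaryGroup.LocalRing L v)ˣ),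
              glDiagonal 2 (UnitaryGroup.LocalRing L v) d' = ((y * γH * y⁻¹).1.val : GL (Fin 2) (UnitaryGroup.LocalRing L v))) →
          ∑ᶠ c : ConjClasses ((UnitaryGroup.cmDatum L 3 (Matrix.of fun i j : Fin 3 => if i.val + j.val + 1 = 3 then (1 : L) else 0)).Local v), ((finExplicitCollection L (Matrix.of fun i j : Fin 3 => if i.val + j.val + 1 = 3 then (1 : L) else 0) μ (finExplicitDelta_conj_left_all L (Matrix.of fun i j : Fin 3 => if i.val + j.val + 1 = 3 then (1 : L) else 0) μ) (finExplicitDelta_conj_right_all L (Matrix.of fun i j : Fin 3 => if i.val + j.val + 1 = 3 then (1 : L) else 0) μ)) v).Δ γH (Quotient.out c) * classOrbitalIntegral mG₃ ((gselStar 1) L v w hw ϖ) c =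
            ∑ s, coef s * stableOrbitalIntegralRel (IsLocalStablyConjH L v) mH (ψ s) γH)) :
    PieceRowsWild gselStar 1 := by
  -- ★ p858837 at `j := 1` with U2G's ★ dictionary and ★ (D-CΔ)-S at the schedule; it remains to produce its frame-currency `hDH`
  refine pieceRowsWild_gselStar_of_frameSignedCensus shift N₀ 1 pieceCountDictionary_transvPlus (fourFrameTransferFactorS_any shift N₀) ?_
  intro L _i1 _i2 _i3 v w hw he h2 ϖ hϖ d tE hD _iF δ hδ hδ0 μ hμu hμω _i4 _i5 _i6 _i7 _i8 _i9 _i10 _i11 νH _i12 _i13 νG₃ _i14 _i15 mH mG₃ hmH hmG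
  -- (H-T+)′: one H-side family for the three rows, row (1) in the law's closed form
  obtain ⟨r, ψ, hψ, coef, ⟨V, hV, h1⟩, hr2, hr3⟩ := hH L w hw he h2 ϖ hϖ d tE hD δ hδ hδ0 μ hμu hμω νH νG₃ mH mG₃ hmH hmG
  refine ⟨r, ψ, hψ, coef, ⟨V, hV, ?_⟩, hr2, hr3⟩
  intro γH hγ hreg f hf a b z ha hb hz hzγ hra hrb ha1 hb1 n₁ n₂ n₃ hE k hk Γ hΓ tb htb i B hB hNP hrel
  rw [h1 γH hγ hreg f hf a b z ha hb hz hzγ hra hrb ha1 hb1 n₁ n₂ n₃ hE k hk Γ hΓ tb htb i B hB hNP hrel]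
  congr 1
  -- the dyadic fence holds at this wild place (`2 ∉ 𝒪_w^×`), so the law is available at the datum `(L_w, σ_w, ϖ, d, t_E)`
  have hv2 : Valued.v (2 : w.1.adicCompletion L) < 1 :=
    v_two_lt_one_of_not_isUnit_two fun h => h2 (isUnit_two_valuationInteger_of_isUnit_two L w.1 h)
  -- the count selector reads `d = dOfPlace`, `m* = mstarOfRecord d`
  have hd : dOfPlace L v w = d := dOfPlace_eq_of_isRamifiedQuadraticDatum L w hw he hD
  have hcnt : ∀ b' : Fin 4, cntStar 1 L v w hw ϖ (Γ b') =
      transvPlusFixCount (galAdicCompletionMap (L := L) (IsCMField.complexConj L) hw) ϖ d (d % 2) (mstarOfRecord d) (Γ b') := by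
    intro b'
    show cntTransvPlus L v w hw ϖ (Γ b') = _
    simp only [cntTransvPlus, mstarFn, hd]
  have hlaw := hL (galAdicCompletionMap (L := L) (IsCMField.complexConj L) hw) ϖ d tE hv2 hD f hf δ hδ hδ0 a b ha hb ha1 hb1 n₁ n₂ n₃ hE Γ hΓ k hk i B hB
  have hC := congrArg (fun x : ℚ => (x : ℂ)) hlaw
  simp only [hcnt]
  push_cast at hC ⊢
  exact hC.symm

/-! ## §4  (V1) row (1) in the law's closed form from the sign-free, depth-only H-side identity (★ p855299 with `ampl ↦ A`; piece-free) -/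

/-- **(V1) `rowOne_of_hSideIdentity_token`** — ★ p855299 `rowOne_of_hSideIdentity` TOKEN FOR TOKEN with `ampl q k B′ ↦ A q d t_E k B`, the sign `Ω_i` riding inside the
amplitude, the anchor's `N, K_t, τ, t` binders dropped: IF near `1`, on the row-(1) data, `Σ_s coef_s·Φ^st(γ_H, ψ_s) = C · (q_v^{(n₁+n₂)∕2})⁻¹ · (Ω_i · A(q_w, d, t_E, k, B))`, THEN
row (1) of (H-T+)′ (`= Δ‴(γ_H, t_{b₀}) · C · (Ω_i·baseSign i·normSign (fPartProd δ (a,b,1) i)) · A(…)`) holds for `(ψ, coef)`.  ★ «Δ2» (amplitude-generic) + ★ «T∕P» + ★ «E».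
[cite: Rogawski1990, §4.9 Prop. 4.9.1 (a) p. 55; Lemma 4.9.3 (4.9.2) p. 56] [cite: LanglandsShelstad1987, §3] [cite: LabesseLanglands1979, §2 (2.1)–(2.2)] -/
theorem rowOne_of_hSideIdentity_token (shift : ℕ → ℕ → ℤ) (Ω : OmegaSchedule) (N₀ : ℕ → ℕ) (A : ℕ → ℕ → ℕ → ℕ → ℤ → ℚ)
    (L : Type) [Field L] [NumberField L] [IsCMField L]
      {v : HeightOneSpectrum (𝓞 ↥(maximalRealSubfield L))} (w : UnitaryGroup.PlacesOver L v)
      (hw : IsCMField.complexConj L • w.1 = w.1) (_he : v.asIdeal.ramificationIdx' w.1.asIdeal ≠ 1)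
      (_h2 : ¬ IsUnit (2 : 𝒪[w.1.adicCompletion L]))
      (ϖ : (w.1.adicCompletion L)) (_hϖ : Valued.v ϖ = WithZero.exp (-1 : ℤ)) (d tE : ℕ) (_hD : IsRamifiedQuadraticDatum (galAdicCompletionMap (L := L) (IsCMField.complexConj L) hw) ϖ d tE)
      [Fintype (Valued.ResidueField (w.1.adicCompletion L))] (δ : (w.1.adicCompletion L)) (_hδ : (galAdicCompletionMap (L := L) (IsCMField.complexConj L) hw) δ = -δ) (_hδ0 : δ ≠ 0)
      (μ : HeckeCharacter L) (_hμu : μ.IsUnitary)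
      (_hμω : ∀ x : ideleGroup ↥(maximalRealSubfield L), μ (AdeleRing.ideleBaseChange ↥(maximalRealSubfield L) L x) = quadraticHeckeCharCM L x)
      [MeasurableSpace ((UnitaryGroup.cmDatum L 3 (Matrix.of fun i j : Fin 3 => if i.val + j.val + 1 = 3 then (1 : L) else 0)).Local v)] [BorelSpace ((UnitaryGroup.cmDatum L 3 (Matrix.of fun i j : Fin 3 => if i.val + j.val + 1 = 3 then (1 : L) else 0)).Local v)]
      [∀ γ : ((UnitaryGroup.cmDatum L 3 (Matrix.of fun i j : Fin 3 => if i.val + j.val + 1 = 3 then (1 : L) else 0)).Local v), MeasurableSpace (((UnitaryGroup.cmDatum L 3 (Matrix.of fun i j : Fin 3 => if i.val + j.val + 1 = 3 then (1 : L) else 0)).Local v) ⧸ Subgroup.centralizer ({γ} : Set ((UnitaryGroup.cmDatum L 3 (Matrix.of fun i j : Fin 3 => if i.val + j.val + 1 = 3 then (1 : L) else 0)).Local v)))]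
      [∀ γ : ((UnitaryGroup.cmDatum L 3 (Matrix.of fun i j : Fin 3 => if i.val + j.val + 1 = 3 then (1 : L) else 0)).Local v), BorelSpace (((UnitaryGroup.cmDatum L 3 (Matrix.of fun i j : Fin 3 => if i.val + j.val + 1 = 3 then (1 : L) else 0)).Local v) ⧸ Subgroup.centralizer ({γ} : Set ((UnitaryGroup.cmDatum L 3 (Matrix.of fun i j : Fin 3 => if i.val + j.val + 1 = 3 then (1 : L) else 0)).Local v)))]
      [MeasurableSpace ((UnitaryGroup.cmDatum L 2 (Matrix.of fun i j : Fin 2 => if i.val + j.val + 1 = 2 then (1 : L) else 0)).Local v × (UnitaryGroup.cmDatum L 1 (Matrix.of fun i j : Fin 1 => if i.val + j.val + 1 = 1 then (1 : L) else 0)).Local v)] [BorelSpace ((UnitaryGroup.cmDatum L 2 (Matrix.of fun i j : Fin 2 => if i.val + j.val + 1 = 2 then (1 : L) else 0)).Local v × (UnitaryGroup.cmDatum L 1 (Matrix.of fun i j : Fin 1 => if i.val + j.val + 1 = 1 then (1 : L) else 0)).Local v)]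
      [∀ a : ((UnitaryGroup.cmDatum L 2 (Matrix.of fun i j : Fin 2 => if i.val + j.val + 1 = 2 then (1 : L) else 0)).Local v × (UnitaryGroup.cmDatum L 1 (Matrix.of fun i j : Fin 1 => if i.val + j.val + 1 = 1 then (1 : L) else 0)).Local v), MeasurableSpace (((UnitaryGroup.cmDatum L 2 (Matrix.of fun i j : Fin 2 => if i.val + j.val + 1 = 2 then (1 : L) else 0)).Local v × (UnitaryGroup.cmDatum L 1 (Matrix.of fun i j : Fin 1 => if i.val + j.val + 1 = 1 then (1 : L) else 0)).Local v) ⧸ Subgroup.centralizer ({a} : Set ((UnitaryGroup.cmDatum L 2 (Matrix.of fun i j : Fin 2 => if i.val + j.val + 1 = 2 then (1 : L) else 0)).Local v × (UnitaryGroup.cmDatum L 1 (Matrix.of fun i j : Fin 1 => if i.val + j.val + 1 = 1 then (1 : L) else 0)).Local v)))]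
      [∀ a : ((UnitaryGroup.cmDatum L 2 (Matrix.of fun i j : Fin 2 => if i.val + j.val + 1 = 2 then (1 : L) else 0)).Local v × (UnitaryGroup.cmDatum L 1 (Matrix.of fun i j : Fin 1 => if i.val + j.val + 1 = 1 then (1 : L) else 0)).Local v), BorelSpace (((UnitaryGroup.cmDatum L 2 (Matrix.of fun i j : Fin 2 => if i.val + j.val + 1 = 2 then (1 : L) else 0)).Local v × (UnitaryGroup.cmDatum L 1 (Matrix.of fun i j : Fin 1 => if i.val + j.val + 1 = 1 then (1 : L) else 0)).Local v) ⧸ Subgroup.centralizer ({a} : Set ((UnitaryGroup.cmDatum L 2 (Matrix.of fun i j : Fin 2 => if i.val + j.val + 1 = 2 then (1 : L) else 0)).Local v × (UnitaryGroup.cmDatum L 1 (Matrix.of fun i j : Fin 1 => if i.val + j.val + 1 = 1 then (1 : L) else 0)).Local v)))]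
      (νH : Measure ((UnitaryGroup.cmDatum L 2 (Matrix.of fun i j : Fin 2 => if i.val + j.val + 1 = 2 then (1 : L) else 0)).Local v × (UnitaryGroup.cmDatum L 1 (Matrix.of fun i j : Fin 1 => if i.val + j.val + 1 = 1 then (1 : L) else 0)).Local v)) [νH.IsHaarMeasure] [νH.IsMulRightInvariant]
      (νG₃ : Measure ((UnitaryGroup.cmDatum L 3 (Matrix.of fun i j : Fin 3 => if i.val + j.val + 1 = 3 then (1 : L) else 0)).Local v)) [νG₃.IsHaarMeasure] [νG₃.IsMulRightInvariant]
      (mH : OrbitalMeasureFamily ((UnitaryGroup.cmDatum L 2 (Matrix.of fun i j : Fin 2 => if i.val + j.val + 1 = 2 then (1 : L) else 0)).Local v × (UnitaryGroup.cmDatum L 1 (Matrix.of fun i j : Fin 1 => if i.val + j.val + 1 = 1 then (1 : L) else 0)).Local v)) (mG₃ : OrbitalMeasureFamily ((UnitaryGroup.cmDatum L 3 (Matrix.of fun i j : Fin 3 => if i.val + j.val + 1 = 3 then (1 : L) else 0)).Local v))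
      (_hmH : mH.IsCanonical (IsLocalGRegular L v) νH) (_hmG : mG₃.IsCanonical (fun γ => IsRegularElt (γ.val : GL (Fin 3) (UnitaryGroup.LocalRing L v))) νG₃)
      (C : ℂ)
      {r : ℕ} (ψ : Fin r → ((UnitaryGroup.cmDatum L 2 (Matrix.of fun i j : Fin 2 => if i.val + j.val + 1 = 2 then (1 : L) else 0)).Local v × (UnitaryGroup.cmDatum L 1 (Matrix.of fun i j : Fin 1 => if i.val + j.val + 1 = 1 then (1 : L) else 0)).Local v) → ℂ) (coef : Fin r → ℂ)
      (hH :
        (∃ V ∈ 𝓝 (1 : ((UnitaryGroup.cmDatum L 2 (Matrix.of fun i j : Fin 2 => if i.val + j.val + 1 = 2 then (1 : L) else 0)).Local v × (UnitaryGroup.cmDatum L 1 (Matrix.of fun i j : Fin 1 => if i.val + j.val + 1 = 1 then (1 : L) else 0)).Local v)), ∀ γH ∈ V, IsLocalGRegular L v γH →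
          ∀ (f : Fin 4 → Fin 3 → (Fin 3 → (w.1.adicCompletion L))) (_hf : IsFourFrameFamily (galAdicCompletionMap (L := L) (IsCMField.complexConj L) hw) f)
        (a b z : (w.1.adicCompletion L)) (_ha : a * (galAdicCompletionMap (L := L) (IsCMField.complexConj L) hw) a = 1) (_hb : b * (galAdicCompletionMap (L := L) (IsCMField.complexConj L) hw) b = 1) (_hz : z * (galAdicCompletionMap (L := L) (IsCMField.complexConj L) hw) z = 1)
        (_hzγ : z = finGammaTwo L v γH w) (_hra : ((((γH).1.val : GL (Fin 2) (UnitaryGroup.LocalRing L v)).val.map (Pi.evalRingHom (fun w' : UnitaryGroup.PlacesOver L v => w'.1.adicCompletion L) w))).charpoly.IsRoot (z * (a * a))) (_hrb : ((((γH).1.val : GL (Fin 2) (UnitaryGroup.LocalRing L v)).val.map (Pi.evalRingHom (fun w' : UnitaryGroup.PlacesOver L v => w'.1.adicCompletion L) w))).charpoly.IsRoot (z * (b * b)))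
        (_ha1 : Valued.v (a - 1) < Valued.v (2 : (w.1.adicCompletion L))) (_hb1 : Valued.v (b - 1) < Valued.v (2 : (w.1.adicCompletion L)))
        (n₁ n₂ n₃ : ℕ) (_hE : IsElementDatum (galAdicCompletionMap (L := L) (IsCMField.complexConj L) hw) ϖ (N₀ d) (a * a) (b * b) n₁ n₂ n₃)
        (k : ℕ) (_hk : 2 * k + d = n₁ + n₂ + n₃ + 2)
        (Γ : Fin 4 → GL (Fin 3) (w.1.adicCompletion L)) (_hΓ : ∀ b', (Γ b' : Matrix (Fin 3) (Fin 3) (w.1.adicCompletion L)) = frameElt (galAdicCompletionMap (L := L) (IsCMField.complexConj L) hw) f b' (a * a) (b * b))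
        (tb : Fin 4 → ((UnitaryGroup.cmDatum L 3 (Matrix.of fun i j : Fin 3 => if i.val + j.val + 1 = 3 then (1 : L) else 0)).Local v)) (_htb : ∀ b', ((((localNonsplitEquiv (IsCMField.complexConj L) (Matrix.of fun i j : Fin 3 => if i.val + j.val + 1 = 3 then (1 : L) else 0) (IsCMField.complexConj_ne_one L) w hw (tb b') :
              ↥(unitaryGroupOfForm (galAdicCompletionMap (L := L) (IsCMField.complexConj L) hw) (placeForm (Matrix.of fun i j : Fin 3 => if i.val + j.val + 1 = 3 then (1 : L) else 0) w.1))) : GL (Fin 3) (w.1.adicCompletion L)) : Matrix (Fin 3) (Fin 3) (w.1.adicCompletion L))) = z • (Γ b' : Matrix (Fin 3) (Fin 3) (w.1.adicCompletion L)))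
            (i : Fin 3) (B : ℤ), 2 * B = ((![n₁, n₂, n₃] : Fin 3 → ℕ) i : ℤ) - d + 2 - 2 * shift d tE →
            (∀ t' : ((UnitaryGroup.cmDatum L 3 (Matrix.of fun i j : Fin 3 => if i.val + j.val + 1 = 3 then (1 : L) else 0)).Local v), IsLocalNormPair L (Matrix.of fun i j : Fin 3 => if i.val + j.val + 1 = 3 then (1 : L) else 0) v γH t' ↔ ∃ b', ConjClasses.mk t' = ConjClasses.mk (tb b')) →
            (∀ b' : Fin 4, ((finExplicitCollection L (Matrix.of fun i j : Fin 3 => if i.val + j.val + 1 = 3 then (1 : L) else 0) μ (finExplicitDelta_conj_left_all L (Matrix.of fun i j : Fin 3 => if i.val + j.val + 1 = 3 then (1 : L) else 0) μ) (finExplicitDelta_conj_right_all L (Matrix.of fun i j : Fin 3 => if i.val + j.val + 1 = 3 then (1 : L) else 0) μ)) v).Δ γH (tb b') = ((finExplicitCollection L (Matrix.of fun i j : Fin 3 => if i.val + j.val + 1 = 3 then (1 : L) else 0) μ (finExplicitDelta_conj_left_all L (Matrix.of fun i j : Fin 3 => if i.val + j.val + 1 = 3 then (1 : L) else 0) μ)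 (finExplicitDelta_conj_right_all L (Matrix.of fun i j : Fin 3 => if i.val + j.val + 1 = 3 then (1 : L) else 0) μ)) v).Δ γH (tb 0) * (kappaChar i b' : ℂ)) →
            ∑ s, coef s * stableOrbitalIntegralRel (IsLocalStablyConjH L v) mH (ψ s) γH =
              C * ((((Nat.card (𝓞 ↥(maximalRealSubfield L) ⧸ v.asIdeal) : ℂ)) ^ ((n₁ + n₂) / 2)))⁻¹ * (((Ω (w.1.adicCompletion L) (galAdicCompletionMap (L := L) (IsCMField.complexConj L) hw) ϖ d a b i : ℤ) : ℂ) * ((A (Fintype.card (Valued.ResidueField (w.1.adicCompletion L))) d tE k B : ℚ) : ℂ)))) :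
        (∃ V ∈ 𝓝 (1 : ((UnitaryGroup.cmDatum L 2 (Matrix.of fun i j : Fin 2 => if i.val + j.val + 1 = 2 then (1 : L) else 0)).Local v × (UnitaryGroup.cmDatum L 1 (Matrix.of fun i j : Fin 1 => if i.val + j.val + 1 = 1 then (1 : L) else 0)).Local v)), ∀ γH ∈ V, IsLocalGRegular L v γH →
          ∀ (f : Fin 4 → Fin 3 → (Fin 3 → (w.1.adicCompletion L))) (_hf : IsFourFrameFamily (galAdicCompletionMap (L := L) (IsCMField.complexConj L) hw) f)
        (a b z : (w.1.adicCompletion L)) (_ha : a * (galAdicCompletionMap (L := L) (IsCMField.complexConj L) hw) a = 1) (_hb : b * (galAdicCompletionMap (L := L) (IsCMField.complexConj L) hw) b = 1) (_hz : z * (galAdicCompletionMap (L := L) (IsCMField.complexConj L) hw) z = 1)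
        (_hzγ : z = finGammaTwo L v γH w) (_hra : ((((γH).1.val : GL (Fin 2) (UnitaryGroup.LocalRing L v)).val.map (Pi.evalRingHom (fun w' : UnitaryGroup.PlacesOver L v => w'.1.adicCompletion L) w))).charpoly.IsRoot (z * (a * a))) (_hrb : ((((γH).1.val : GL (Fin 2) (UnitaryGroup.LocalRing L v)).val.map (Pi.evalRingHom (fun w' : UnitaryGroup.PlacesOver L v => w'.1.adicCompletion L) w))).charpoly.IsRoot (z * (b * b)))
        (_ha1 : Valued.v (a - 1) < Valued.v (2 : (w.1.adicCompletion L))) (_hb1 : Valued.v (b - 1) < Valued.v (2 : (w.1.adicCompletion L)))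
        (n₁ n₂ n₃ : ℕ) (_hE : IsElementDatum (galAdicCompletionMap (L := L) (IsCMField.complexConj L) hw) ϖ (N₀ d) (a * a) (b * b) n₁ n₂ n₃)
        (k : ℕ) (_hk : 2 * k + d = n₁ + n₂ + n₃ + 2)
        (Γ : Fin 4 → GL (Fin 3) (w.1.adicCompletion L)) (_hΓ : ∀ b', (Γ b' : Matrix (Fin 3) (Fin 3) (w.1.adicCompletion L)) = frameElt (galAdicCompletionMap (L := L) (IsCMField.complexConj L) hw) f b' (a * a) (b * b))
        (tb : Fin 4 → ((UnitaryGroup.cmDatum L 3 (Matrix.of fun i j : Fin 3 => if i.val + j.val + 1 = 3 then (1 : L) else 0)).Local v)) (_htb : ∀ b', ((((localNonsplitEquiv (IsCMField.complexConj L) (Matrix.of fun i j : Fin 3 => if i.val + j.val + 1 = 3 then (1 : L) else 0) (IsCMField.complexConj_ne_one L) w hw (tb b') :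
              ↥(unitaryGroupOfForm (galAdicCompletionMap (L := L) (IsCMField.complexConj L) hw) (placeForm (Matrix.of fun i j : Fin 3 => if i.val + j.val + 1 = 3 then (1 : L) else 0) w.1))) : GL (Fin 3) (w.1.adicCompletion L)) : Matrix (Fin 3) (Fin 3) (w.1.adicCompletion L))) = z • (Γ b' : Matrix (Fin 3) (Fin 3) (w.1.adicCompletion L)))
            (i : Fin 3) (B : ℤ), 2 * B = ((![n₁, n₂, n₃] : Fin 3 → ℕ) i : ℤ) - d + 2 - 2 * shift d tE →
            (∀ t' : ((UnitaryGroup.cmDatum L 3 (Matrix.of fun i j : Fin 3 => if i.val + j.val + 1 = 3 then (1 : L) else 0)).Local v), IsLocalNormPair L (Matrix.of fun i j : Fin 3 => if i.val + j.val + 1 = 3 then (1 : L) else 0) v γH t' ↔ ∃ b', ConjClasses.mk t' = ConjClasses.mk (tb b')) →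
            (∀ b' : Fin 4, ((finExplicitCollection L (Matrix.of fun i j : Fin 3 => if i.val + j.val + 1 = 3 then (1 : L) else 0) μ (finExplicitDelta_conj_left_all L (Matrix.of fun i j : Fin 3 => if i.val + j.val + 1 = 3 then (1 : L) else 0) μ) (finExplicitDelta_conj_right_all L (Matrix.of fun i j : Fin 3 => if i.val + j.val + 1 = 3 then (1 : L) else 0) μ)) v).Δ γH (tb b') = ((finExplicitCollection L (Matrix.of fun i j : Fin 3 => if i.val + j.val + 1 = 3 then (1 : L) else 0) μ (finExplicitDelta_conj_left_all L (Matrix.of fun i j : Fin 3 => if i.val + j.val + 1 = 3 then (1 : L) else 0) μ) (finExplicitDelta_conj_right_all L (Matrix.of fun i j : Fin 3 => if i.val + j.val + 1 = 3 then (1 : L) else 0) μ)) v).Δ γH (tb 0) * (kappaChar i b' : ℂ)) →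
            ∑ s, coef s * stableOrbitalIntegralRel (IsLocalStablyConjH L v) mH (ψ s) γH =
              ((finExplicitCollection L (Matrix.of fun i j : Fin 3 => if i.val + j.val + 1 = 3 then (1 : L) else 0) μ (finExplicitDelta_conj_left_all L (Matrix.of fun i j : Fin 3 => if i.val + j.val + 1 = 3 then (1 : L) else 0) μ) (finExplicitDelta_conj_right_all L (Matrix.of fun i j : Fin 3 => if i.val + j.val + 1 = 3 then (1 : L) else 0) μ)) v).Δ γH (tb 0) * C *
                (((Ω (w.1.adicCompletion L) (galAdicCompletionMap (L := L) (IsCMField.complexConj L) hw) ϖ d a b i * (baseSign (galAdicCompletionMap (L := L) (IsCMField.complexConj L) hw) i * normSign (galAdicCompletionMap (L := L) (IsCMField.complexConj L) hw) (fPartProd δ ![a, b, 1] i)) : ℤ) : ℂ) *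
                  ((A (Fintype.card (Valued.ResidueField (w.1.adicCompletion L))) d tE k B : ℚ) : ℂ))) := by
  classical
  obtain ⟨V₁, hV₁, h₁⟩ := hH
  obtain ⟨V₂, hV₂, h₂⟩ := exists_nhds_one_forall_rowOne_rhs_collapse L v w hw μ _hμω
  obtain ⟨V₃, hV₃, h₃⟩ := eventually_nhds_one_forall_canonicalRoot_deep L v w hw
  refine ⟨V₁ ∩ (V₂ ∩ V₃), Filter.inter_mem hV₁ (Filter.inter_mem hV₂ hV₃), ?_⟩
  intro γH hγ hreg f hf a b z ha hb hz hzγ hra hrb ha1 hb1 n₁ n₂ n₃ hE k hk Γ hΓ tb htb i B hB hnorm hrel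
  have hab : a * a ≠ b * b := hE.2.2.1
  have hn₁ : Valued.v (b * b - 1) = Valued.v ϖ ^ n₁ := hE.2.2.2.2.2.1
  have hn₂ : Valued.v (a * a - 1) = Valued.v ϖ ^ n₂ := hE.2.2.2.2.2.2.1
  obtain ⟨-, htok⟩ := valued_rootProduct_eq_toPlace_pow_half_of_datum L v w hw _he _hD _hδ _hδ0 ha hb hz hn₂ hn₁
  have ha8 := h₃ γH hγ.2.2 a z ha hz ha1 hzγ hra
  have hb8 := h₃ γH hγ.2.2 b z hb hz hb1 hzγ hrb
  have hcol := h₂ γH hγ.2.1 hreg f hf δ a b z ((n₁ + n₂) / 2) _hδ _hδ0 ha hb hz ha8 hb8 hab hzγ hra hrb htok Γ hΓ tb htb hnorm i hrel C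
    (((Ω (w.1.adicCompletion L) (galAdicCompletionMap (L := L) (IsCMField.complexConj L) hw) ϖ d a b i : ℤ) : ℂ) *
      ((A (Fintype.card (Valued.ResidueField (w.1.adicCompletion L))) d tE k B : ℚ) : ℂ))
  rw [h₁ γH hγ.1 hreg f hf a b z ha hb hz hzγ hra hrb ha1 hb1 n₁ n₂ n₃ hE k hk Γ hΓ tb htb i B hB hnorm hrel, ← hcol]
  push_cast
  ring


/-! ## §5  (V2) the sign-free identity for `hFamily` from ONE affine arithmetic hypothesis on the token (★ p858715; piece-free) -/

/-- **(V2) `exists_coef_hSideIdentity_hFamily_of_affine_token`.**  For constants `C cA cB : ℂ` and a depth floor `N₁`: IF on the row data (slot `i = 2`, `n₁ + n₂` even,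
`2k + d = n₁ + n₂ + n₃ + 2`, `2B = n₃ − d + 2 − 2·shift d t_E`, `N₁ ≤ n₃`, `n₃ + d` even; `a, b`, the element datum handed for `Ω`) the collapsed amplitude is affine,
`C · (q_w^{(n₁+n₂)∕2})⁻¹ · (Ω_w(a,b,i) · A(q_w, d, t_E, k, B)) = cA · V(n₃) + cB` with `V(N) = 2(q^{(N−d)∕2+1} − 1)∕(q − 1)` (★ (ρ1a)'s token), THEN `∃ coef : Fin 2 → ℂ` with
§4's hypothesis for `ψ := hFamily`.  ★ p858715 + ★ p855670 §1 (depth floor `max N₁ (depthOfRecord d)` near `1`) + slot `i = 2` (as ★ p855481) + `q_v = q_w` (★ ramified CM).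
[cite: Rogawski1990, §4.9 Prop. 4.9.1 (b) p. 55, Lemma 4.9.3 p. 56] [cite: LabesseLanglands1979, §2 (2.2)] -/
theorem exists_coef_hSideIdentity_hFamily_of_affine_token (shift : ℕ → ℕ → ℤ) (Ω : OmegaSchedule) (N₀ : ℕ → ℕ) (A : ℕ → ℕ → ℕ → ℕ → ℤ → ℚ)
    (L : Type) [Field L] [NumberField L] [IsCMField L]
      {v : HeightOneSpectrum (𝓞 ↥(maximalRealSubfield L))} (w : UnitaryGroup.PlacesOver L v)
      (hw : IsCMField.complexConj L • w.1 = w.1) (_he : v.asIdeal.ramificationIdx' w.1.asIdeal ≠ 1)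
      (_h2 : ¬ IsUnit (2 : 𝒪[w.1.adicCompletion L]))
      (ϖ : (w.1.adicCompletion L)) (_hϖ : Valued.v ϖ = WithZero.exp (-1 : ℤ)) (d tE : ℕ) (_hD : IsRamifiedQuadraticDatum (galAdicCompletionMap (L := L) (IsCMField.complexConj L) hw) ϖ d tE)
      [Fintype (Valued.ResidueField (w.1.adicCompletion L))] (δ : (w.1.adicCompletion L)) (_hδ : (galAdicCompletionMap (L := L) (IsCMField.complexConj L) hw) δ = -δ) (_hδ0 : δ ≠ 0)
      (μ : HeckeCharacter L) (_hμu : μ.IsUnitary)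
      (_hμω : ∀ x : ideleGroup ↥(maximalRealSubfield L), μ (AdeleRing.ideleBaseChange ↥(maximalRealSubfield L) L x) = quadraticHeckeCharCM L x)
      [MeasurableSpace ((UnitaryGroup.cmDatum L 3 (Matrix.of fun i j : Fin 3 => if i.val + j.val + 1 = 3 then (1 : L) else 0)).Local v)] [BorelSpace ((UnitaryGroup.cmDatum L 3 (Matrix.of fun i j : Fin 3 => if i.val + j.val + 1 = 3 then (1 : L) else 0)).Local v)]
      [∀ γ : ((UnitaryGroup.cmDatum L 3 (Matrix.of fun i j : Fin 3 => if i.val + j.val + 1 = 3 then (1 : L) else 0)).Local v), MeasurableSpace (((UnitaryGroup.cmDatum L 3 (Matrix.of fun i j : Fin 3 => if i.val + j.val + 1 = 3 then (1 : L) else 0)).Local v) ⧸ Subgroup.centralizer ({γ} : Set ((UnitaryGroup.cmDatum L 3 (Matrix.of fun i j : Fin 3 => if i.val + j.val + 1 = 3 then (1 : L) else 0)).Local v)))]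
      [∀ γ : ((UnitaryGroup.cmDatum L 3 (Matrix.of fun i j : Fin 3 => if i.val + j.val + 1 = 3 then (1 : L) else 0)).Local v), BorelSpace (((UnitaryGroup.cmDatum L 3 (Matrix.of fun i j : Fin 3 => if i.val + j.val + 1 = 3 then (1 : L) else 0)).Local v) ⧸ Subgroup.centralizer ({γ} : Set ((UnitaryGroup.cmDatum L 3 (Matrix.of fun i j : Fin 3 => if i.val + j.val + 1 = 3 then (1 : L) else 0)).Local v)))]
      [MeasurableSpace ((UnitaryGroup.cmDatum L 2 (Matrix.of fun i j : Fin 2 => if i.val + j.val + 1 = 2 then (1 : L) else 0)).Local v × (UnitaryGroup.cmDatum L 1 (Matrix.of fun i j : Fin 1 => if i.val + j.val + 1 = 1 then (1 : L) else 0)).Local v)] [BorelSpace ((UnitaryGroup.cmDatum L 2 (Matrix.of fun i j : Fin 2 => if i.val + j.val + 1 = 2 then (1 : L) else 0)).Local v × (UnitaryGroup.cmDatum L 1 (Matrix.of fun i j : Fin 1 => if i.val + j.val + 1 = 1 then (1 : L) else 0)).Local v)]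
      [∀ a : ((UnitaryGroup.cmDatum L 2 (Matrix.of fun i j : Fin 2 => if i.val + j.val + 1 = 2 then (1 : L) else 0)).Local v × (UnitaryGroup.cmDatum L 1 (Matrix.of fun i j : Fin 1 => if i.val + j.val + 1 = 1 then (1 : L) else 0)).Local v), MeasurableSpace (((UnitaryGroup.cmDatum L 2 (Matrix.of fun i j : Fin 2 => if i.val + j.val + 1 = 2 then (1 : L) else 0)).Local v × (UnitaryGroup.cmDatum L 1 (Matrix.of fun i j : Fin 1 => if i.val + j.val + 1 = 1 then (1 : L) else 0)).Local v) ⧸ Subgroup.centralizer ({a} : Set ((UnitaryGroup.cmDatum L 2 (Matrix.of fun i j : Fin 2 => if i.val + j.val + 1 = 2 then (1 : L) else 0)).Local v × (UnitaryGroup.cmDatum L 1 (Matrix.of fun i j : Fin 1 => if i.val + j.val + 1 = 1 then (1 : L) else 0)).Local v)))]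
      [∀ a : ((UnitaryGroup.cmDatum L 2 (Matrix.of fun i j : Fin 2 => if i.val + j.val + 1 = 2 then (1 : L) else 0)).Local v × (UnitaryGroup.cmDatum L 1 (Matrix.of fun i j : Fin 1 => if i.val + j.val + 1 = 1 then (1 : L) else 0)).Local v), BorelSpace (((UnitaryGroup.cmDatum L 2 (Matrix.of fun i j : Fin 2 => if i.val + j.val + 1 = 2 then (1 : L) else 0)).Local v × (UnitaryGroup.cmDatum L 1 (Matrix.of fun i j : Fin 1 => if i.val + j.val + 1 = 1 then (1 : L) else 0)).Local v) ⧸ Subgroup.centralizer ({a} : Set ((UnitaryGroup.cmDatum L 2 (Matrix.of fun i j : Fin 2 => if i.val + j.val + 1 = 2 then (1 : L) else 0)).Local v × (UnitaryGroup.cmDatum L 1 (Matrix.of fun i j : Fin 1 => if i.val + j.val + 1 = 1 then (1 : L) else 0)).Local v)))]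
      (νH : Measure ((UnitaryGroup.cmDatum L 2 (Matrix.of fun i j : Fin 2 => if i.val + j.val + 1 = 2 then (1 : L) else 0)).Local v × (UnitaryGroup.cmDatum L 1 (Matrix.of fun i j : Fin 1 => if i.val + j.val + 1 = 1 then (1 : L) else 0)).Local v)) [νH.IsHaarMeasure] [νH.IsMulRightInvariant]
      (νG₃ : Measure ((UnitaryGroup.cmDatum L 3 (Matrix.of fun i j : Fin 3 => if i.val + j.val + 1 = 3 then (1 : L) else 0)).Local v)) [νG₃.IsHaarMeasure] [νG₃.IsMulRightInvariant]
      (mH : OrbitalMeasureFamily ((UnitaryGroup.cmDatum L 2 (Matrix.of fun i j : Fin 2 => if i.val + j.val + 1 = 2 then (1 : L) else 0)).Local v × (UnitaryGroup.cmDatum L 1 (Matrix.of fun i j : Fin 1 => if i.val + j.val + 1 = 1 then (1 : L) else 0)).Local v)) (mG₃ : OrbitalMeasureFamily ((UnitaryGroup.cmDatum L 3 (Matrix.of fun i j : Fin 3 => if i.val + j.val + 1 = 3 then (1 : L) else 0)).Local v))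
      (_hmH : mH.IsCanonical (IsLocalGRegular L v) νH) (_hmG : mG₃.IsCanonical (fun γ => IsRegularElt (γ.val : GL (Fin 3) (UnitaryGroup.LocalRing L v))) νG₃)
      (C cA cB : ℂ) (N₁ : ℕ)
      (hA : ∀ (a b : (w.1.adicCompletion L)) (n₁ n₂ n₃ k : ℕ) (i : Fin 3) (B : ℤ),
        a * (galAdicCompletionMap (L := L) (IsCMField.complexConj L) hw) a = 1 → b * (galAdicCompletionMap (L := L) (IsCMField.complexConj L) hw) b = 1 →
        IsElementDatum (galAdicCompletionMap (L := L) (IsCMField.complexConj L) hw) ϖ (N₀ d) (a * a) (b * b) n₁ n₂ n₃ →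
        2 * ((n₁ + n₂) / 2) = n₁ + n₂ → 2 * k + d = n₁ + n₂ + n₃ + 2 → 2 * B = ((![n₁, n₂, n₃] : Fin 3 → ℕ) i : ℤ) - d + 2 - 2 * shift d tE → i = 2 →
        N₁ ≤ n₃ → (n₃ + d) % 2 = 0 →
        C * ((Fintype.card (Valued.ResidueField (w.1.adicCompletion L)) : ℂ) ^ ((n₁ + n₂) / 2))⁻¹ * (((Ω (w.1.adicCompletion L) (galAdicCompletionMap (L := L) (IsCMField.complexConj L) hw) ϖ d a b i : ℤ) : ℂ) * ((A (Fintype.card (Valued.ResidueField (w.1.adicCompletion L))) d tE k B : ℚ) : ℂ)) =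
          cA * (((2 * ((Fintype.card (Valued.ResidueField (w.1.adicCompletion L)) : ℚ) ^ (((n₃ - d) / 2 : ℕ) + 1) - 1) / ((Fintype.card (Valued.ResidueField (w.1.adicCompletion L)) : ℚ) - 1) : ℚ)) : ℂ) + cB) :
      ∃ coef : Fin 2 → ℂ,
        (∃ V ∈ 𝓝 (1 : ((UnitaryGroup.cmDatum L 2 (Matrix.of fun i j : Fin 2 => if i.val + j.val + 1 = 2 then (1 : L) else 0)).Local v × (UnitaryGroup.cmDatum L 1 (Matrix.of fun i j : Fin 1 => if i.val + j.val + 1 = 1 then (1 : L) else 0)).Local v)), ∀ γH ∈ V, IsLocalGRegular L v γH →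
          ∀ (f : Fin 4 → Fin 3 → (Fin 3 → (w.1.adicCompletion L))) (_hf : IsFourFrameFamily (galAdicCompletionMap (L := L) (IsCMField.complexConj L) hw) f)
        (a b z : (w.1.adicCompletion L)) (_ha : a * (galAdicCompletionMap (L := L) (IsCMField.complexConj L) hw) a = 1) (_hb : b * (galAdicCompletionMap (L := L) (IsCMField.complexConj L) hw) b = 1) (_hz : z * (galAdicCompletionMap (L := L) (IsCMField.complexConj L) hw) z = 1)
        (_hzγ : z = finGammaTwo L v γH w) (_hra : ((((γH).1.val : GL (Fin 2) (UnitaryGroup.LocalRing L v)).val.map (Pi.evalRingHom (fun w' : UnitaryGroup.PlacesOver L v => w'.1.adicCompletion L) w))).charpoly.IsRoot (z * (a * a))) (_hrb : ((((γH).1.val : GL (Fin 2) (UnitaryGroup.LocalRing L v)).val.map (Pi.evalRingHom (fun w' : UnitaryGroup.PlacesOver L v => w'.1.adicCompletion L) w))).charpoly.IsRoot (z * (b * b)))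
        (_ha1 : Valued.v (a - 1) < Valued.v (2 : (w.1.adicCompletion L))) (_hb1 : Valued.v (b - 1) < Valued.v (2 : (w.1.adicCompletion L)))
        (n₁ n₂ n₃ : ℕ) (_hE : IsElementDatum (galAdicCompletionMap (L := L) (IsCMField.complexConj L) hw) ϖ (N₀ d) (a * a) (b * b) n₁ n₂ n₃)
        (k : ℕ) (_hk : 2 * k + d = n₁ + n₂ + n₃ + 2)
        (Γ : Fin 4 → GL (Fin 3) (w.1.adicCompletion L)) (_hΓ : ∀ b', (Γ b' : Matrix (Fin 3) (Fin 3) (w.1.adicCompletion L)) = frameElt (galAdicCompletionMap (L := L) (IsCMField.complexConj L) hw) f b' (a * a) (b * b))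
        (tb : Fin 4 → ((UnitaryGroup.cmDatum L 3 (Matrix.of fun i j : Fin 3 => if i.val + j.val + 1 = 3 then (1 : L) else 0)).Local v)) (_htb : ∀ b', ((((localNonsplitEquiv (IsCMField.complexConj L) (Matrix.of fun i j : Fin 3 => if i.val + j.val + 1 = 3 then (1 : L) else 0) (IsCMField.complexConj_ne_one L) w hw (tb b') :
              ↥(unitaryGroupOfForm (galAdicCompletionMap (L := L) (IsCMField.complexConj L) hw) (placeForm (Matrix.of fun i j : Fin 3 => if i.val + j.val + 1 = 3 then (1 : L) else 0) w.1))) : GL (Fin 3) (w.1.adicCompletion L)) : Matrix (Fin 3) (Fin 3) (w.1.adicCompletion L))) = z • (Γ b' : Matrix (Fin 3) (Fin 3) (w.1.adicCompletion L)))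
            (i : Fin 3) (B : ℤ), 2 * B = ((![n₁, n₂, n₃] : Fin 3 → ℕ) i : ℤ) - d + 2 - 2 * shift d tE →
            (∀ t' : ((UnitaryGroup.cmDatum L 3 (Matrix.of fun i j : Fin 3 => if i.val + j.val + 1 = 3 then (1 : L) else 0)).Local v), IsLocalNormPair L (Matrix.of fun i j : Fin 3 => if i.val + j.val + 1 = 3 then (1 : L) else 0) v γH t' ↔ ∃ b', ConjClasses.mk t' = ConjClasses.mk (tb b')) →
            (∀ b' : Fin 4, ((finExplicitCollection L (Matrix.of fun i j : Fin 3 => if i.val + j.val + 1 = 3 then (1 : L) else 0) μ (finExplicitDelta_conj_left_all L (Matrix.of fun i j : Fin 3 => if i.val + j.val + 1 = 3 then (1 : L) else 0) μ) (finExplicitDelta_conj_right_all L (Matrix.of fun i j : Fin 3 => if i.val + j.val + 1 = 3 then (1 : L) else 0) μ)) v).Δ γH (tb b') = ((finExplicitCollection L (Matrix.of fun i j : Fin 3 => if i.val + j.val + 1 = 3 then (1 : L) else 0) μ (finExplicitDelta_conj_left_all L (Matrix.of fun i j : Fin 3 => if i.val + j.val + 1 = 3 then (1 : L) else 0) μ)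 (finExplicitDelta_conj_right_all L (Matrix.of fun i j : Fin 3 => if i.val + j.val + 1 = 3 then (1 : L) else 0) μ)) v).Δ γH (tb 0) * (kappaChar i b' : ℂ)) →
            ∑ s, coef s * stableOrbitalIntegralRel (IsLocalStablyConjH L v) mH (hFamily L w hw ϖ s) γH =
              C * ((((Nat.card (𝓞 ↥(maximalRealSubfield L) ⧸ v.asIdeal) : ℂ)) ^ ((n₁ + n₂) / 2)))⁻¹ * (((Ω (w.1.adicCompletion L) (galAdicCompletionMap (L := L) (IsCMField.complexConj L) hw) ϖ d a b i : ℤ) : ℂ) * ((A (Fintype.card (Valued.ResidueField (w.1.adicCompletion L))) d tE k B : ℚ) : ℂ))) := by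
  classical
  -- ★ p858715: the affine-complete type-(1) supply of `hFamily`, at the target `cA·V + cB`
  obtain ⟨coef, V₁, hV₁, h⟩ := exists_coef_hFamily_affine L w hw _he _h2 ϖ _hϖ d tE _hD νH mH _hmH cA cB
  -- ★ p855670 §1: near `1` the eigenvalue depth exceeds `max N₁ (depthOfRecord d)`
  obtain ⟨V₂, hV₂, hdeep⟩ := (eventually_nhds_one_le_depth L v w ϖ _hϖ (max N₁ (depthOfRecord d))).exists_mem
  refine ⟨coef, V₁ ∩ V₂, Filter.inter_mem hV₁ hV₂, ?_⟩
  intro γH hγ hreg f hf a b z ha hb hz hzγ hra hrb ha1 hb1 n₁ n₂ n₃ hE k hk Γ hΓ tb htb i B hB hnorm hrel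
  have hab : a * a ≠ b * b := hE.2.2.1
  have hn₁ : Valued.v (b * b - 1) = Valued.v ϖ ^ n₁ := hE.2.2.2.2.2.1
  have hn₂ : Valued.v (a * a - 1) = Valued.v ϖ ^ n₂ := hE.2.2.2.2.2.2.1
  have hn₃ : Valued.v (a * a - b * b) = Valued.v ϖ ^ n₃ := hE.2.2.2.2.2.2.2.1
  -- parity of `n₁ + n₂` (★ «T∕P») and of `n₃ + d`
  obtain ⟨hev, -⟩ := valued_rootProduct_eq_toPlace_pow_half_of_datum L v w hw _he _hD _hδ _hδ0 ha hb hz hn₂ hn₁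
  have hpar : (n₃ + d) % 2 = 0 := by omega
  -- the slot is `i = 2` (as in ★ p855481)
  have hC : ∀ b', IsLocalNormPair L (Matrix.of fun i j : Fin 3 => if i.val + j.val + 1 = 3 then (1 : L) else 0) v γH (tb b') :=
    fun b' => (hnorm (tb b')).2 ⟨b', rfl⟩
  have hu := isUnit_eval_finCharpolyTwo_of_isLocalGRegular L v γH hreg
  have hD0 : ((finExplicitCollection L (Matrix.of fun i j : Fin 3 => if i.val + j.val + 1 = 3 then (1 : L) else 0) μ
      (finExplicitDelta_conj_left_all L (Matrix.of fun i j : Fin 3 => if i.val + j.val + 1 = 3 then (1 : L) else 0) μ)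
      (finExplicitDelta_conj_right_all L (Matrix.of fun i j : Fin 3 => if i.val + j.val + 1 = 3 then (1 : L) else 0) μ)) v).Δ γH (tb 0) ≠ 0 := by
    rw [finExplicitCollection_Δ]
    exact finExplicitDelta_ne_zero_of_isUnit L v _ γH (tb 0) μ (hC 0) hu
  have hi : i = 2 := by
    refine slot_eq_two_of_kappaChar_eq hD0 fun b' => ?_
    rw [← hrel b']
    exact F0P3cDyRamTransferFactorTypeOne.delta_frame_eq_mul_kappaChar L w hw μ γH hreg hf hzγ hΓ htb hC b'
  -- the roots `α = z·a²`, `γ = z·b²`: distinct, norm one, of depth `n₃` (as in ★ p855670)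
  have hvz : Valued.v z = 1 := valued_eq_one_of_mul_map_eq_one L v w hw hz
  have hz0 : z ≠ 0 := fun h0 => by rw [h0, map_zero] at hvz; exact zero_ne_one hvz
  have hαγ : z * (a * a) ≠ z * (b * b) := fun h' => hab (mul_left_cancel₀ hz0 h')
  have hα1 : z * (a * a) * (galAdicCompletionMap (L := L) (IsCMField.complexConj L) hw) (z * (a * a)) = 1 := by
    rw [map_mul, map_mul]
    calc z * (a * a) * ((galAdicCompletionMap (L := L) (IsCMField.complexConj L) hw) z * ((galAdicCompletionMap (L := L) (IsCMField.complexConj L) hw) a * (galAdicCompletionMap (L := L) (IsCMField.complexConj L) hw) a))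
        = (z * (galAdicCompletionMap (L := L) (IsCMField.complexConj L) hw) z) * ((a * (galAdicCompletionMap (L := L) (IsCMField.complexConj L) hw) a) * (a * (galAdicCompletionMap (L := L) (IsCMField.complexConj L) hw) a)) := by ring
      _ = 1 := by rw [hz, ha, one_mul, one_mul]
  have hγ1 : z * (b * b) * (galAdicCompletionMap (L := L) (IsCMField.complexConj L) hw) (z * (b * b)) = 1 := by
    rw [map_mul, map_mul]
    calc z * (b * b) * ((galAdicCompletionMap (L := L) (IsCMField.complexConj L) hw) z * ((galAdicCompletionMap (L := L) (IsCMField.complexConj L) hw) b * (galAdicCompletionMap (L := L) (IsCMField.complexConj L) hw) b))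
        = (z * (galAdicCompletionMap (L := L) (IsCMField.complexConj L) hw) z) * ((b * (galAdicCompletionMap (L := L) (IsCMField.complexConj L) hw) b) * (b * (galAdicCompletionMap (L := L) (IsCMField.complexConj L) hw) b)) := by ring
      _ = 1 := by rw [hz, hb, one_mul, one_mul]
  have hdepth : Valued.v (z * (a * a) - z * (b * b)) = WithZero.exp (-(n₃ : ℤ)) := by
    rw [← mul_sub, map_mul, hvz, one_mul, hn₃, _hϖ, ← WithZero.exp_nsmul, nsmul_eq_mul, mul_neg, mul_one]
  have hmax : max N₁ (depthOfRecord d) ≤ n₃ := hdeep γH hγ.2 (z * (a * a)) (z * (b * b)) hra hrb hαγ n₃ hdepth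
  have hN₁ : N₁ ≤ n₃ := le_trans (le_max_left _ _) hmax
  have hN₀ : depthOfRecord d ≤ n₃ := le_trans (le_max_right _ _) hmax
  -- `q_v = q_w` at the ramified place
  have hq : Fintype.card (Valued.ResidueField (w.1.adicCompletion L)) = Nat.card (𝓞 ↥(maximalRealSubfield L) ⧸ v.asIdeal) := by
    rw [← Nat.card_eq_fintype_card]; exact natCard_valuedResidueField_eq_of_ramified_CM L v w hw _he
  rw [h γH hγ.1 hreg (z * (a * a)) (z * (b * b)) hra hrb hαγ hα1 hγ1 n₃ hdepth hN₀ hpar,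
    ← hA a b n₁ n₂ n₃ k i B ha hb hE hev hk hB hi hN₁ hpar, hq]



end Summit.HodgeConjecture.HodgeConjecture.Cruxes.H413.F0P3cDyRamPieceRowOneTokenVehicles

end
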